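import Summits.BirchSwinnertonDyer.BirchSwinnertonDyer.Theorems.ManinLocalTwoThreeShimuraIndexOptimalPair
import Literature.NumberTheory.EllipticCurves.AgasheRibetStein2006.ManinConstantOptimalCurves
import Literature.NumberTheory.EllipticCurves.IsogenyIdProofs
import HarnessLib

/-!
# THE OPTIMAL PAIR MODULO CREMONA'S TABLE: for `N ≤ 130000`, `|c₁| = 1` (Stevens' `c₁ = ±1` from `|c₀| = 1` and ČNS 6.5) and
# `Λ₁(f) = Λ₀(f) ⟺ c₄(E₁) = c₄(E₀) ∧ c₆(E₁) = c₆(E₀) ⟺ Λ_{E₁} = Λ_{E₀}` — «the Shimura quotient of a class is trivial iff its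
# Stevens curve is its optimal curve», modulo ONE published fact

Summit `BirchSwinnertonDyer`, route `ManinLocalTwoThree` (cell bsd-f2-manin), crux C2 `ManinOddAtFour` (stmt-BirchSwinnertonDyer-22967).
Planner seat bsd-f2-manin-es (LENS es), gen 46; TURNKEY T-es-116 for the C2/C3 LEAD — to be proposed AFTER T-es-115
(`…ShimuraIndexOptimalPair`, which this file imports).

CONTENT.  The fact-free equivalence of T-es-115, `Λ₁(f) = Λ₀(f) ⟺ (c₄, c₆ agree ∧ |c₀| = |c₁|)` for the optimal pair (E₁ Stevens'
`X₁(N)`-optimal curve with optimal datum `D₁`, E₀ the `X₀(N)`-optimal curve with lattice-optimal datum `D₀`, minimal models, isogenous),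
has its last conjunct discharged by ONE named fact, Cremona's table `cremona_abs_maninConstant_eq_one_of_level_le` (`|c₀| = 1` for
lattice-optimal `X₀(N)`-data at `N ≤ 130000`, Agashe–Ribet–Stein Thm. 2.6): since `c₁ ∣ c₀` (ČNS Lemma 6.5, a tree THEOREM
`IsOptimal.maninConstant_dvd_maninConstant`), `|c₁| = 1` as well (§5 `natAbs_maninConstant₁_eq_one_of_cremona` — Stevens' conjecture in
Cremona's range, as ČNS §1 remark), so **`Λ₁(f) = Λ₀(f) ⟺ (c₄(E₁) = c₄(E₀) ∧ c₆(E₁) = c₆(E₀)) ⟺ Λ_{E₁} = Λ_{E₀}`** and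
**`[Λ₀(f) : Λ₁(f)] ≠ 1 ⟺ E₁ ≠ E₀`** (`c₄` or `c₆` differ) for every class of level `≤ 130000`; plus the fact-free dichotomy at `4 ∣ N`:
`E₁ = E₀ ∨ [Λ₀ : Λ₁] ∈ {2, 4}`.  This is the typed form of the cell's empirical law (desc §65, es E15/E-es-268): the 926 index-1
classes of E15 are exactly those whose Stevens curve is Cremona's curve 1.

HONEST FRAMING.  Bookkeeping on T-es-115 + one published fact used as a hypothesis binder (no conjecture: Stevens' `c₁ = ±1` is DERIVED
in range, not assumed); printed mathematics (Stevens 1989 §2, ČNS 2024 Lemma 6.5 / §1, Cremona's tables), new formal proof.  No definitions,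
no sorry.  C2, C3, Manin's conjecture and BSD are NOT proved by this file.
[cite: Stevens1989, §2] [cite: CesnaviciusNeururerSaha2023, Lemma 6.5 and §1] [cite: AgasheRibetStein2006, Thm. 2.6 and appendix Thm. 5.2]
[cite: Cremona1997, §2.10 and Table 1] [cite: LingOesterle1991, Thm. 6]
-/

set_option autoImplicit false
-- the summit-side namespace `Summit.BirchSwinnertonDyer.BirchSwinnertonDyer.…` is the tree's (summit = sub-problem)
set_option linter.dupNamespace false

noncomputable section

open scoped Classical MatrixGroups

open CongruenceSubgroup Matrix.SpecialLinearGroup ModularGroup WeierstrassCurve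
open Literature.NumberTheory.EllipticCurves Literature.NumberTheory.EllipticCurves.ModularForms

namespace Summit.BirchSwinnertonDyer.BirchSwinnertonDyer.Theorems.ManinLocalTwoThree.ShimuraIndex

/-! ## §5 Modulo Cremona's table (`|c₀| = 1` for `N ≤ 130000`, a published computation): `|c₁| = 1` for the optimal pair, and
`Λ₁(f) = Λ₀(f) ⟺ c₄, c₆ agree ⟺ Λ_{E₁} = Λ_{E₀}` — «trivial Shimura quotient iff Stevens' curve is the optimal curve» -/

section Cremona

open Literature.NumberTheory.EllipticCurves.AgasheRibetStein2006

variable {W₁ W₀ : WeierstrassCurve ℚ} [W₁.IsElliptic] [W₁.IsGloballyMinimal] [W₀.IsElliptic] [W₀.IsGloballyMinimal]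
  {N : ℕ} [NeZero N]

omit [W₁.IsElliptic] [W₁.IsGloballyMinimal] in
/-- Cremona's fact in `natAbs` form: `|c₀| = 1` for a lattice-optimal `X₀(N)`-datum at level `N ≤ 130000`.
[cite: AgasheRibetStein2006, Thm. 2.6] [cite: Cremona1997, §2.10] -/
theorem natAbs_maninConstant₀_eq_one_of_cremona (hC : cremona_abs_maninConstant_eq_one_of_level_le)
    (D₀ : ModularParametrizationData W₀ N) (h₀ : ∀ z ∈ D₀.L.lattice, ∃ w ∈ periodLattice D₀.f, z = D₀.c * w)
    (hN : N ≤ 130000) : D₀.maninConstant.natAbs = 1 := by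
  have h := hC W₀ D₀ h₀ hN
  rw [Int.abs_eq_natAbs] at h
  exact_mod_cast h

/-- **Stevens' `c₁ = ±1` for `N ≤ 130000`, from Cremona's table and ČNS Lemma 6.5** (`c₁ ∣ c₀`, tree theorem): the optimal
`X₁(N)`-datum of a class whose `X₀(N)`-optimal constant is `±1` has constant `±1`.
[cite: CesnaviciusNeururerSaha2023, Lemma 6.5 and §1] [cite: AgasheRibetStein2006, Thm. 2.6] [cite: Stevens1989, Conj.] -/
theorem natAbs_maninConstant₁_eq_one_of_cremona (hC : cremona_abs_maninConstant_eq_one_of_level_le)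
    (D₁ : Gamma1ParametrizationData W₁ N) (h₁ : D₁.IsOptimal) (D₀ : ModularParametrizationData W₀ N)
    (hiso : IsIsogenous W₁ W₀) (h₀ : ∀ z ∈ D₀.L.lattice, ∃ w ∈ periodLattice D₀.f, z = D₀.c * w) (hN : N ≤ 130000) :
    D₁.maninConstant.natAbs = 1 :=
  Nat.dvd_one.mp (natAbs_maninConstant₀_eq_one_of_cremona hC D₀ h₀ hN ▸
    Int.natAbs_dvd_natAbs.mpr (h₁.maninConstant_dvd_maninConstant D₀ hiso))

/-- Modulo Cremona: `|c₀| = |c₁|` (`= 1`) for the optimal pair at `N ≤ 130000`. [cite: AgasheRibetStein2006, Thm. 2.6] [cite: CesnaviciusNeururerSaha2023, Lemma 6.5] -/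
theorem natAbs_maninConstant₀_eq_natAbs_maninConstant₁_of_cremona (hC : cremona_abs_maninConstant_eq_one_of_level_le)
    (D₁ : Gamma1ParametrizationData W₁ N) (h₁ : D₁.IsOptimal) (D₀ : ModularParametrizationData W₀ N)
    (hiso : IsIsogenous W₁ W₀) (h₀ : ∀ z ∈ D₀.L.lattice, ∃ w ∈ periodLattice D₀.f, z = D₀.c * w) (hN : N ≤ 130000) :
    D₀.maninConstant.natAbs = D₁.maninConstant.natAbs := by
  rw [natAbs_maninConstant₀_eq_one_of_cremona hC D₀ h₀ hN, natAbs_maninConstant₁_eq_one_of_cremona hC D₁ h₁ D₀ hiso h₀ hN]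

/-- **Modulo Cremona (`N ≤ 130000`): `Λ₁(f) = Λ₀(f) ⟺ (c₄(E₁) = c₄(E₀) ∧ c₆(E₁) = c₆(E₀))`** — the Shimura quotient of a class is
trivial iff its Stevens curve is its optimal curve. [cite: Stevens1989, §2] [cite: AgasheRibetStein2006, Thm. 2.6] [cite: CesnaviciusNeururerSaha2023, Lemma 6.5] -/
theorem periodLatticeGamma1_eq_iff_c₄_eq_and_c₆_eq_of_cremona (hC : cremona_abs_maninConstant_eq_one_of_level_le)
    (D₁ : Gamma1ParametrizationData W₁ N) (h₁ : D₁.IsOptimal) (D₀ : ModularParametrizationData W₀ N)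
    (hiso : IsIsogenous W₁ W₀) (h₀ : ∀ z ∈ D₀.L.lattice, ∃ w ∈ periodLattice D₀.f, z = D₀.c * w) (hN : N ≤ 130000) :
    periodLatticeGamma1 D₀.f = periodLattice D₀.f ↔ W₁.c₄ = W₀.c₄ ∧ W₁.c₆ = W₀.c₆ := by
  rw [periodLatticeGamma1_eq_iff_c₄_eq_and_c₆_eq_and_natAbs_eq D₁ h₁ D₀ hiso h₀]
  have habs := natAbs_maninConstant₀_eq_natAbs_maninConstant₁_of_cremona hC D₁ h₁ D₀ hiso h₀ hN
  exact ⟨fun h ↦ ⟨h.1, h.2.1⟩, fun h ↦ ⟨h.1, h.2, habs⟩⟩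

/-- **Modulo Cremona (`N ≤ 130000`): `Λ₁(f) = Λ₀(f) ⟺ Λ_{E₁} = Λ_{E₀}`.** [cite: Stevens1989, §2] [cite: AgasheRibetStein2006, Thm. 2.6] -/
theorem periodLatticeGamma1_eq_iff_lattice_eq_of_cremona (hC : cremona_abs_maninConstant_eq_one_of_level_le)
    (D₁ : Gamma1ParametrizationData W₁ N) (h₁ : D₁.IsOptimal) (D₀ : ModularParametrizationData W₀ N)
    (hiso : IsIsogenous W₁ W₀) (h₀ : ∀ z ∈ D₀.L.lattice, ∃ w ∈ periodLattice D₀.f, z = D₀.c * w) (hN : N ≤ 130000) :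
    periodLatticeGamma1 D₀.f = periodLattice D₀.f ↔ D₁.L.lattice = D₀.L.lattice :=
  ⟨lattice_eq_of_periodLatticeGamma1_eq D₁ h₁ D₀ hiso h₀, fun hL ↦
    (periodLatticeGamma1_eq_iff_natAbs_eq_of_lattice_eq D₁ h₁ D₀ hiso h₀ hL).mpr
      (natAbs_maninConstant₀_eq_natAbs_maninConstant₁_of_cremona hC D₁ h₁ D₀ hiso h₀ hN)⟩

/-- **Modulo Cremona (`N ≤ 130000`): `[Λ₀(f) : Λ₁(f)] ≠ 1 ⟺ E₁ ≠ E₀`** (`c₄` or `c₆` differ).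
[cite: Stevens1989, §2] [cite: AgasheRibetStein2006, Thm. 2.6] [cite: LingOesterle1991, Thm. 6] -/
theorem relIndex_ne_one_iff_c₄_ne_or_c₆_ne_of_cremona (hC : cremona_abs_maninConstant_eq_one_of_level_le)
    (D₁ : Gamma1ParametrizationData W₁ N) (h₁ : D₁.IsOptimal) (D₀ : ModularParametrizationData W₀ N)
    (hiso : IsIsogenous W₁ W₀) (h₀ : ∀ z ∈ D₀.L.lattice, ∃ w ∈ periodLattice D₀.f, z = D₀.c * w) (hN : N ≤ 130000) :
    (periodLatticeGamma1 D₀.f).relIndex (periodLattice D₀.f) ≠ 1 ↔ (W₁.c₄ ≠ W₀.c₄ ∨ W₁.c₆ ≠ W₀.c₆) := by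
  have key := periodLatticeGamma1_eq_iff_c₄_eq_and_c₆_eq_of_cremona hC D₁ h₁ D₀ hiso h₀ hN
  have hidx : (periodLatticeGamma1 D₀.f).relIndex (periodLattice D₀.f) = 1 ↔
      periodLatticeGamma1 D₀.f = periodLattice D₀.f :=
    ⟨fun h ↦ le_antisymm (periodLatticeGamma1_le_periodLattice _) (AddSubgroup.relIndex_eq_one.mp h),
     fun h ↦ AddSubgroup.relIndex_eq_one.mpr h.ge⟩
  rw [Ne, hidx, key, not_and_or]

/-- **At `4 ∣ N` (no facts): `E₁ = E₀` (same `c₄, c₆`) or `[Λ₀(f) : Λ₁(f)] ∈ {2, 4}`** — the dichotomy form of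
`relIndex_eq_two_or_four_of_four_dvd_of_c₄_ne_or_c₆_ne`. [cite: Stevens1989, §2] [cite: LingOesterle1991, Thm. 6] -/
theorem c₄_eq_and_c₆_eq_or_relIndex_eq_two_or_four_of_four_dvd
    (D₁ : Gamma1ParametrizationData W₁ N) (h₁ : D₁.IsOptimal) (D₀ : ModularParametrizationData W₀ N)
    (hiso : IsIsogenous W₁ W₀) (h₀ : ∀ z ∈ D₀.L.lattice, ∃ w ∈ periodLattice D₀.f, z = D₀.c * w)
    (h4 : 2 ^ 2 ∣ N) :
    (W₁.c₄ = W₀.c₄ ∧ W₁.c₆ = W₀.c₆) ∨ (periodLatticeGamma1 D₀.f).relIndex (periodLattice D₀.f) = 2 ∨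
      (periodLatticeGamma1 D₀.f).relIndex (periodLattice D₀.f) = 4 := by
  by_cases hne : W₁.c₄ ≠ W₀.c₄ ∨ W₁.c₆ ≠ W₀.c₆
  · exact Or.inr (relIndex_eq_two_or_four_of_four_dvd_of_c₄_ne_or_c₆_ne D₁ h₁ D₀ hiso h₀ h4 hne)
  · rw [not_or, not_not, not_not] at hne
    exact Or.inl hne

/-- **Modulo Cremona (`N ≤ 130000`): a class whose `X₀(N)`-optimal curve is also `X₁(N)`-optimal (one minimal model `W₀` carrying both
an optimal `X₁(N)`-datum and a lattice-optimal `X₀(N)`-datum) has trivial Shimura quotient, `Λ₁(f) = Λ₀(f)`.**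
[cite: Stevens1989, §2] [cite: AgasheRibetStein2006, Thm. 2.6] [cite: CesnaviciusNeururerSaha2023, Lemma 6.5] -/
theorem periodLatticeGamma1_eq_of_sameCurve_of_cremona (hC : cremona_abs_maninConstant_eq_one_of_level_le)
    (D₁ : Gamma1ParametrizationData W₀ N) (h₁ : D₁.IsOptimal) (D₀ : ModularParametrizationData W₀ N)
    (h₀ : ∀ z ∈ D₀.L.lattice, ∃ w ∈ periodLattice D₀.f, z = D₀.c * w) (hN : N ≤ 130000) :
    periodLatticeGamma1 D₀.f = periodLattice D₀.f :=
  (periodLatticeGamma1_eq_iff_c₄_eq_and_c₆_eq_of_cremona hC D₁ h₁ D₀ (isIsogenous_self W₀) h₀ hN).mpr ⟨rfl, rfl⟩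

/-- Modulo Cremona (`N ≤ 130000`), index form: `X₀`-optimal = `X₁`-optimal ⟹ `[Λ₀(f) : Λ₁(f)] = 1`. [cite: Stevens1989, §2] [cite: AgasheRibetStein2006, Thm. 2.6] -/
theorem relIndex_eq_one_of_sameCurve_of_cremona (hC : cremona_abs_maninConstant_eq_one_of_level_le)
    (D₁ : Gamma1ParametrizationData W₀ N) (h₁ : D₁.IsOptimal) (D₀ : ModularParametrizationData W₀ N)
    (h₀ : ∀ z ∈ D₀.L.lattice, ∃ w ∈ periodLattice D₀.f, z = D₀.c * w) (hN : N ≤ 130000) :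
    (periodLatticeGamma1 D₀.f).relIndex (periodLattice D₀.f) = 1 :=
  AddSubgroup.relIndex_eq_one.mpr (periodLatticeGamma1_eq_of_sameCurve_of_cremona hC D₁ h₁ D₀ h₀ hN).ge

end Cremona

end Summit.BirchSwinnertonDyer.BirchSwinnertonDyer.Theorems.ManinLocalTwoThree.ShimuraIndex
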